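import Mathlib
import Summits.NavierStokesRegularity.NavierStokesRegularity.Theorems.FilamentSkeletonRssClause13LowSliceGain
import Summits.NavierStokesRegularity.NavierStokesRegularity.Theorems.FilamentSkeletonRssClause13LiaSymbolNegWindow
import Summits.NavierStokesRegularity.NavierStokesRegularity.Theorems.FilamentSkeletonRssClause13LiaSymbolDerivWindow
import Summits.NavierStokesRegularity.NavierStokesRegularity.Theorems.FilamentSkeletonRssClause13SymbolDecay

/-!
# Clause 13-J/13-R, brick n3 (SYMBOL FACTS ON THE FIVE WINDOWS): the one-signed sizes of `𝔖` / `𝔖′` that the piece profiles need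

Route `FilamentSkeletonRss`, ∃-side clause 13 (`Clause13RNearStraightL` stmt-NavierStokesRegularity-23612; typing-agnostic); design
`filament-plan/DESIGN-28296-model-gluing-g16-v2-addendum.md` §A.  The model theorem `model_l2_estimate` asks of the kernel profiles only WHERE they live:
S1 in `{(2/q)𝔖 ≤ −κ_S1}`, the band in `{𝔖′ ≥ σ₀}`, MID and the transition piece in `{(2/q)𝔖 ≥ κ_M}`.  This file turns the landed symbol facts
(`liaSym_le_quarter_sq_mul_log` p68xxxx, `liaSym_asymp`, `liaSym_le_neg_window` p698454, `deriv_liaSym_ge_band` p699146, `one_sub_liaSym_le_exp`) into the three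
window statements used by the profile construction:
* `liaSym_le_neg_S1`: for `0 < x_s ≤ 1/10` and `x_s/2 ≤ |x| ≤ 19/20`, `𝔖(x) ≤ −(x_s²/16)·log(2/x_s)` (the S1 gain keeps the `log(1/x_s) ≍ log Γ`);
* `liaSym_ge_MID`: `𝔖(x) ≥ 1/50` for `|x| ≥ 7/2`;
* `deriv_liaSym_ge_band_const`: `𝔖′(x) ≥ 153/4000` for `17/20 ≤ x ≤ 18/5`;
with the monotonicity of `x ↦ x²log(1/x)` on `(0, 1/5]` (`sq_mul_log_inv_mono`) and the numerics `log 20 < 3`, `e^{7/4} ≥ 5.1` as lemmas.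
Lane ns-filament-19175-p1 g17; `--supports stmt-NavierStokesRegularity-23612 --as helper`.
HONEST FRAMING: real analysis of the explicit symbol of a HYPOTHETICAL filament skeleton's model operator on the NEGATIVE side of a MODEL route; nothing
here bears on Navier–Stokes regularity or blow-up.
-/

noncomputable section

open Real Set

namespace Summit.NavierStokesRegularity.NavierStokesRegularity.Theorems.AnalyticStripLiaSymbol
set_option linter.dupNamespace false

/-! ## §1 Elementary numerics and the monotonicity of `x²log(1/x)` -/

/-- `log 20 < 3` (`e³ > 20.08`). [folklore] -/
theorem log_twenty_lt_three : Real.log 20 < 3 := by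
  have he := Real.exp_one_gt_d9
  have h3 : (20 : ℝ) < Real.exp 3 := by
    rw [show (3 : ℝ) = 1 + 1 + 1 by norm_num, Real.exp_add, Real.exp_add]
    nlinarith [Real.exp_pos 1]
  calc Real.log 20 < Real.log (Real.exp 3) := Real.log_lt_log (by norm_num) h3
    _ = 3 := Real.log_exp 3

/-- `log 16 < 2.8` (`4·log 2`). [folklore] -/
theorem log_sixteen_lt : Real.log 16 < 2.8 := by
  rw [show (16 : ℝ) = 2 ^ 4 by norm_num, Real.log_pow]
  have := Real.log_two_lt_d9
  push_cast
  linarith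

/-- `e^{7/4} ≥ 5.139` (`e · (e^{3/8})² ≥ 2.71828·(11/8)²`). [folklore] -/
theorem exp_seven_quarters_ge : (5139 / 1000 : ℝ) ≤ Real.exp (7 / 4) := by
  have he := Real.exp_one_gt_d9
  have h38 : (11 / 8 : ℝ) ≤ Real.exp (3 / 8) := by
    have := Real.add_one_le_exp (3 / 8 : ℝ); linarith
  have hsq : (11 / 8 : ℝ) ^ 2 ≤ Real.exp (3 / 4) := by
    rw [show (3 / 4 : ℝ) = 3 / 8 + 3 / 8 by norm_num, Real.exp_add, sq]
    exact mul_le_mul h38 h38 (by norm_num) (Real.exp_pos _).le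
  rw [show (7 / 4 : ℝ) = 1 + 3 / 4 by norm_num, Real.exp_add]
  nlinarith [Real.exp_pos (3 / 4 : ℝ), Real.exp_pos (1 : ℝ)]

/-- **`x ↦ x²·log(1/x)` is monotone on `(0, 1/5]`**: for `0 < u ≤ v ≤ 1/5`, `u²log(1/u) ≤ v²log(1/v)`
(derivative `x(2log(1/x) − 1) ≥ 0` as long as `log(1/x) ≥ 1/2`, i.e. `x ≤ e^{−1/2}`; `1/5 < e^{−1/2}`). [folklore] -/
theorem sq_mul_log_inv_mono {u v : ℝ} (hu : 0 < u) (huv : u ≤ v) (hv : v ≤ 1 / 5) :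
    u ^ 2 * Real.log (1 / u) ≤ v ^ 2 * Real.log (1 / v) := by
  set f : ℝ → ℝ := fun x => x ^ 2 * Real.log (1 / x) with hf
  set f' : ℝ → ℝ := fun x => 2 * x * Real.log (1 / x) - x with hf'
  have hderiv : ∀ x, 0 < x → HasDerivAt f (f' x) x := by
    intro x hx
    have h1 : HasDerivAt (fun x : ℝ => Real.log (1 / x)) (-x⁻¹) x := by
      have e : (fun x : ℝ => Real.log (1 / x)) = fun x => -Real.log x := by
        funext y; rw [one_div, Real.log_inv]
      rw [e]
      exact (Real.hasDerivAt_log hx.ne').neg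
    have h2 := (hasDerivAt_pow 2 x).mul h1
    refine h2.congr_deriv ?_
    simp only [hf']
    field_simp
    ring
  have hD : Convex ℝ (Icc u v) := convex_Icc u v
  have hcont : ContinuousOn f (Icc u v) := by
    intro x hx
    exact (hderiv x (lt_of_lt_of_le hu hx.1)).continuousAt.continuousWithinAt
  have hmono : MonotoneOn f (Icc u v) := by
    refine monotoneOn_of_hasDerivWithinAt_nonneg hD hcont (f' := f') (fun x hx => ?_) (fun x hx => ?_)
    · rw [interior_Icc] at hx
      exact (hderiv x (hu.trans hx.1)).hasDerivWithinAt
    · rw [interior_Icc] at hx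
      have hx0 : 0 < x := hu.trans hx.1
      have hx5 : x ≤ 1 / 5 := (hx.2.le).trans hv
      -- `log(1/x) ≥ log 5 ≥ 1/2`
      have hlog : 1 / 2 ≤ Real.log (1 / x) := by
        have h5 : (5 : ℝ) ≤ 1 / x := by rw [le_div_iff₀ hx0]; linarith
        have hexp : Real.exp (1 / 2) ≤ 5 := by
          have h := Real.exp_one_lt_d9
          have hhalf : Real.exp (1 / 2) ≤ Real.exp 1 := Real.exp_le_exp.2 (by norm_num)
          linarith
        calc (1 / 2 : ℝ) = Real.log (Real.exp (1 / 2)) := (Real.log_exp _).symm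
          _ ≤ Real.log 5 := Real.log_le_log (Real.exp_pos _) hexp
          _ ≤ Real.log (1 / x) := Real.log_le_log (by norm_num) h5
      simp only [hf']
      nlinarith
  exact hmono (left_mem_Icc.2 huv) (right_mem_Icc.2 huv) huv

/-! ## §2 The S1 window: `𝔖 ≤ −(x_s²/16)log(2/x_s)` on `x_s/2 ≤ |x| ≤ 19/20` -/

/-- On `[1/10, 1/4]`: `𝔖(x) ≤ −x²/5` (Klein–Majda asymptotics with the explicit remainder). [folklore] -/
theorem liaSym_le_neg_mid_low (x : ℝ) (h1 : 1 / 10 ≤ x) (h2 : x ≤ 1 / 4) : liaSym x ≤ -(1 / 5) * x ^ 2 := by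
  have hx : 0 < x := by linarith
  have hasymp := (abs_le.1 (liaSym_asymp x hx (by linarith))).2
  have hγ := Real.eulerMascheroniConstant_lt_two_thirds
  have hlog2 := Real.log_two_gt_d9
  -- `log(x/2) ≤ log(1/8) = −3 log 2`
  have hlx2 : Real.log (x / 2) ≤ -(3 * Real.log 2) := by
    have h : Real.log (x / 2) ≤ Real.log (1 / 8) := Real.log_le_log (by positivity) (by linarith)
    rw [one_div, Real.log_inv, show (8 : ℝ) = 2 ^ 3 by norm_num, Real.log_pow] at h
    push_cast at h
    linarith
  -- `|log x| = −log x ≤ log 16 < 2.8`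
  have hlx : Real.log x < 0 := Real.log_neg hx (by linarith)
  have habs : |Real.log x| ≤ 2.8 := by
    rw [abs_of_neg hlx]
    have h : Real.log (1 / x) ≤ Real.log 16 := Real.log_le_log (by positivity) (by rw [div_le_iff₀ hx]; linarith)
    rw [one_div, Real.log_inv] at h
    linarith [log_sixteen_lt]
  have hx2 : x ^ 2 ≤ 1 / 16 := by nlinarith
  have hx4 : x ^ 4 ≤ x ^ 2 * (1 / 16) := by nlinarith [sq_nonneg x]
  have hmain : x ^ 2 * ((Real.log (x / 2) + Real.eulerMascheroniConstant) / 2 + 1 / 4) ≤ x ^ 2 * (-(9 / 20)) := by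
    refine mul_le_mul_of_nonneg_left ?_ (sq_nonneg x)
    nlinarith
  have hrem : x ^ 4 * (|Real.log x| + 1) ≤ x ^ 2 * (1 / 16) * (3.8) := by
    have h0 : 0 ≤ |Real.log x| + 1 := by positivity
    calc x ^ 4 * (|Real.log x| + 1) ≤ x ^ 2 * (1 / 16) * (|Real.log x| + 1) := mul_le_mul_of_nonneg_right hx4 h0
      _ ≤ x ^ 2 * (1 / 16) * 3.8 := mul_le_mul_of_nonneg_left (by linarith) (by positivity)
  nlinarith [sq_nonneg x]

/-- **THE S1 WINDOW.**  For `0 < x_s ≤ 1/10` and `x_s/2 ≤ |x| ≤ 19/20`: `𝔖(x) ≤ −(x_s²/16)·log(2/x_s)`. [folklore] -/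
theorem liaSym_le_neg_S1 {xs x : ℝ} (hxs : 0 < xs) (hxs' : xs ≤ 1 / 10) (h1 : xs / 2 ≤ |x|) (h2 : |x| ≤ 19 / 20) :
    liaSym x ≤ -(xs ^ 2 / 16 * Real.log (2 / xs)) := by
  -- reduce to `y = |x| > 0`
  have hsymm : liaSym x = liaSym |x| := by
    rcases le_or_gt 0 x with h | h
    · rw [abs_of_nonneg h]
    · rw [abs_of_neg h, liaSym_neg]
  rw [hsymm]
  set y := |x| with hy
  have hy0 : 0 < y := lt_of_lt_of_le (by positivity) h1
  -- the target constant is `g(x_s/2)/4 ≤ (1/1600)·log 20 < 3/1600`, `g(t) = t²log(1/t)`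
  have hg : xs ^ 2 / 16 * Real.log (2 / xs) = (xs / 2) ^ 2 * Real.log (1 / (xs / 2)) / 4 := by
    rw [show 1 / (xs / 2) = 2 / xs by field_simp]; ring
  have hsmall : xs ^ 2 / 16 * Real.log (2 / xs) ≤ 3 / 1600 := by
    rw [hg]
    have hm := sq_mul_log_inv_mono (u := xs / 2) (v := 1 / 20) (by positivity) (by linarith) (by norm_num)
    rw [show (1 : ℝ) / (1 / 20) = 20 by norm_num] at hm
    have h20 := log_twenty_lt_three
    nlinarith
  rcases le_or_gt y (1 / 10) with hA | hA
  · -- `[x_s/2, 1/10]`: `𝔖 ≤ (y²/4)log y = −g(y)/4 ≤ −g(x_s/2)/4`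
    have hle := liaSym_le_quarter_sq_mul_log y hy0 hA
    have hm := sq_mul_log_inv_mono (u := xs / 2) (v := y) (by positivity) h1 (by linarith)
    have e : y ^ 2 / 4 * Real.log y = -(y ^ 2 * Real.log (1 / y)) / 4 := by
      rw [one_div, Real.log_inv]; ring
    rw [hg]
    linarith
  rcases le_or_gt y (1 / 4) with hB | hB
  · -- `[1/10, 1/4]`
    have hle := liaSym_le_neg_mid_low y hA.le hB
    have hy2 : 1 / 100 ≤ y ^ 2 := by nlinarith
    linarith
  · -- `[1/4, 19/20]`
    have hle := liaSym_le_neg_window y hB.le h2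
    linarith

/-! ## §3 The MID window and the band -/

/-- **THE MID WINDOW.**  `𝔖(x) ≥ 1/50` for `|x| ≥ 7/2` (`1 − 𝔖 ≤ 5e^{−7/4} ≤ 5/5.139`). [folklore] -/
theorem liaSym_ge_MID {x : ℝ} (hx : 7 / 2 ≤ |x|) : 1 / 50 ≤ liaSym x := by
  have hsymm : liaSym x = liaSym |x| := by
    rcases le_or_gt 0 x with h | h
    · rw [abs_of_nonneg h]
    · rw [abs_of_neg h, liaSym_neg]
  rw [hsymm]
  set y := |x| with hy
  have hy0 : 0 < y := by linarith
  have h := one_sub_liaSym_le_exp y hy0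
  have hexp : Real.exp (-(y / 2)) ≤ Real.exp (-(7 / 4)) := Real.exp_le_exp.2 (by linarith)
  have h74 : Real.exp (-(7 / 4 : ℝ)) ≤ 1000 / 5139 := by
    rw [Real.exp_neg, inv_le_comm₀ (Real.exp_pos _) (by norm_num)]
    have := exp_seven_quarters_ge
    rw [show ((1000 : ℝ) / 5139)⁻¹ = 5139 / 1000 by norm_num]
    exact this
  linarith

/-- **THE BAND.**  `𝔖′(x) ≥ 153/4000` for `17/20 ≤ x ≤ 18/5` (from `𝔖′ ≥ 9x/200` on `[17/20, 363/100]`). [folklore] -/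
theorem deriv_liaSym_ge_band_const {x : ℝ} (h1 : 17 / 20 ≤ x) (h2 : x ≤ 18 / 5) : 153 / 4000 ≤ deriv liaSym x := by
  have h := deriv_liaSym_ge_band x h1 (by linarith)
  linarith

end Summit.NavierStokesRegularity.NavierStokesRegularity.Theorems.AnalyticStripLiaSymbol

end
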